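import Summits.AtomisticToContinuum.HydrodynamicLimit.Theses.JParityClosure
import Summits.AtomisticToContinuum.HydrodynamicLimit.Theses.InformationPercolationEngine
import Summits.AtomisticToContinuum.HydrodynamicLimit.Theses.LimitCollisionMeasure
import Summits.AtomisticToContinuum.HydrodynamicLimit.Theorems.JParityClosureAssemblyEnergyOneSided
import Summits.AtomisticToContinuum.HydrodynamicLimit.Theorems.InformationPercolationEngineChaosClosesEulerCollisionMomentUI
import Summits.AtomisticToContinuum.HydrodynamicLimit.Theorems.InformationPercolationEngineChaosClosesEulerMassBalanceC1
import Summits.AtomisticToContinuum.HydrodynamicLimit.Theorems.InformationPercolationEngineChaosClosesEulerWeakEquation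
import Summits.AtomisticToContinuum.HydrodynamicLimit.Theorems.InformationPercolationEngineChaosClosesEulerInitialLayer
import Summits.AtomisticToContinuum.HydrodynamicLimit.Theorems.InformationPercolationEngineChaosClosesEulerBF18Shell
import Summits.AtomisticToContinuum.HydrodynamicLimit.Theorems.InformationPercolationEngineChaosClosesEulerKineticReduction
import Summits.AtomisticToContinuum.HydrodynamicLimit.Theorems.JParityClosureParityBandClosurePressureValueOfEvenStress
import Summits.AtomisticToContinuum.HydrodynamicLimit.Theorems.JParityClosureParityBandClosureCoarseEntropy
import Summits.AtomisticToContinuum.HydrodynamicLimit.Theorems.JParityClosureParityBandClosureMomentumAtInstant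
import Summits.AtomisticToContinuum.HydrodynamicLimit.Theorems.JParityClosureParityBandClosureEnergyFloor
import Summits.AtomisticToContinuum.HydrodynamicLimit.Theorems.JParityClosureParityBandClosureEntropyNoDipAtOfHydrodynamicLimit
import Summits.AtomisticToContinuum.HydrodynamicLimit.Theorems.JParityClosureParityInBandDensity
import HarnessLib

/-!
# Line `entropy-floor-fixes-energy` — crux `JParityClosure.ParityBandClosure` (stmt-AtomisticToContinuum-17608), skeleton v3 (planner crux-plan v1; lead a1 reshapes v2, v3)

THE CRUX. `ParityBandClosure := OddContactSymmetry → EvenStressEnskog → RateFloor → LocalSecondLaw → DensityCap →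
_root_.HydrodynamicLimit` — the closure step of route JParityClosure (five physics cruxes ⇒ the packing-guarded
conjunct: `χ`-tested convergence in probability of density / momentum / energy at EVERY `t ∈ [0,T)`).

THE LINE (idea card `Ideas/entropy-floor-fixes-energy.md`, triage r1 pass 3/3). Every closure engine on the board
(Březina–Feireisl relative energy at fixed mollifier scale) delivers the three `r`-cone-mollified empirical fields close
to the classical solution only in TIME AVERAGE (`MollifiedCloseTimeAveraged`, the sister line's typed waypoint, here
verbatim). The passage to the INSTANT `t` is where the crux as filed was found under-hypothesised (gap G1 of the
Assembly twin 17595: the fixed-`t` ENERGY field is invisible to `X`; the dead line `Sketch` and the landed readout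
`ChaosClosesEulerReadout.stub_readout` pay it with the CUBIC tail `EnergyCurrentTails` 9235 + windowed collisional
energy-transfer bounds). This line pays it in ENTROPY instead:

* DENSITY at `t`: from `DensityCap` alone — LANDED (`ParityInBandDensity.parityInBand_densityField_of_densityCap`).
* MOMENTUM at `t` (`stub_momentumAtInstant`, M/L): quadratic time-regularity — the smooth-tested empirical momentum
  has windowed modulus `‖DJ‖_∞(2E_kin·Δ + ε·½𝒮(t,t+Δ])`, `𝒮` the normal-speed-jump functional = the TRACE of the
  `EvenStressEnskog` marks, bounded in small windows by `EvenStressEnskog` + `DensityCap` + the guard — LANDED as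
  `JParityClosureSpeedJumpWindow.hequi_momentum_of_evenStat_of_cap` + the upgrade
  `JParityClosureMomentumModulus.tendsto_momentumObservable_fixedTime_localGibbs`; the stub assembles them with the
  time-averaged identification read off `MollifiedCloseTimeAveraged`.
* ENERGY at `t` (`stub_energyFloorOfEntropyFloor`, L, THE LEVER): hard spheres conserve `Σ|vᵢ|²` EXACTLY, so the
  energy third is ONE-SIDED (LANDED: `Theorems.energyConjunct_of_lower` — lower deviations for `χ ≥ 0` suffice). The
  lower bound is the TANGENT-PLANE inequality of the concave hard-sphere field entropy at the classical state: by
  `fieldEntropy_le_tangent` (PROVED, `Cruxes/ParityBandClosure/IdeatorOneSketch.lean`; it is `log x ≤ x − 1`),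
  `e ≥ θ̃·S_σ(ρ,m,e) − θ̃·ρ s_σ(ρ,θ̃) + (3/2)ρθ̃ + |m|²/(2ρ)` pointwise; concavity of `ρ ↦ ρ s_σ(ρ,θ̃)` on the analytic
  band and `|m|²/(2ρ) ≥ ũ·m − ρ|ũ|²/2` make every remaining term LINEAR in `(ρ_r − ρ̃, m_r − ρ̃ũ)` with continuous
  coefficients, so `∫ψ e_r(t) ≥ ∫ψ Ẽ(t) − η − C‖ρ_r − ρ̃‖₁ − |∫ψũ·(m_r − ρ̃ũ)|` — i.e. the energy floor at `t` follows
  from a `ψθ̃(t)`-weighted ENTROPY FLOOR at `t` (`EntropyNoDipAt`, `stub_entropyNoDipAt`, the line's one new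
  dynamical input), the density cap and the momentum third at `t`. No moment of order `> 2`, no energy-transfer mark,
  no uniform integrability of `|v|²` anywhere in the readout.
* UPSTREAM (`stub_windowClosure`, XL, SHARED by every line of this crux, NOT this line's lever): the five hypotheses
  + the route's quadratic tail support `KineticEnergyTails` (13087, `stub_kineticEnergyTails`, verbatim) ⇒
  `MollifiedCloseTimeAveraged`. Its interior is the business of the other lines (kinetic half ⇒ weak stress isotropy;
  `stub_pressureValueOfEvenStress` LANDED p136561; relative-energy Grönwall — the sister's landed chain with the
  clamped entropy inequality 13352, or card `plain-entropy-finite-n-bf` with the PLAIN `LocalSecondLaw`). AS TYPED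
  its kinetic half inherits the dead line's Young-fibre obstruction on `OddContactSymmetry` 17722 / `RateFloor` 13080
  (`Lines/SketchDead.md`, toy p141493): it refers to those decls BY NAME, so the planner's restatement R-a/R-b
  (`Lines/SketchRepair.lean`) strengthens its hypotheses without touching this file.

`ParityBandClosure_of : JParityClosure.ParityBandClosure` (pure logic + threshold bookkeeping, no `sorry` of its own)
concludes the crux BY NAME from the six stubs (used by name) and landed theorems.

SKELETON v2 (lead a1, 2026-08-17): the lever `stub_energyFloorOfEntropyFloor` is reshaped into TWO registered stubs —
the new deterministic `stub_coarseEntropyIntegrable` (integrability on `𝕋³` of the coarse-grained field entropy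
`x ↦ Hs(ρ_r(x), θ_r(x))` of a configuration with pairwise distinct velocities and capped density: the junk-robustness
input without which the Bochner-integral event of `EntropyNoDipAt` passes VACUOUSLY on a non-integrable dip, `∫ = 0`)
and the squeeze proper, which now takes `CoarseEntropyIntegrable` as its first hypothesis. Composition unchanged
otherwise; 6 stubs ≤ stubs_max.

SKELETON v3 (lead a1, wave-1 integration): the shared upstream `stub_windowClosure` is reshaped along its known anatomy
(worker reply `stub-blocked`, kernel-checked candidate): the POST-isotropy part is now a THEOREM of the skeleton with no
`sorry` — `windowClosure_of_weakStressIsotropy : WeakStressIsotropyInBand → EvenStressEnskog → CollisionTightness(13354) →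
CollisionRate(13481) → LimitCollisionMeasure.LocalSecondLaw(13352, clamped) → DensityCap → MollifiedCloseTimeAveraged`,
literally the sister crux's landed chain (`stub_kineticReduction` p138091 ∘ `stub_bf18Shell` p136414 fed with p133127 /
p108039 / p97752, the pressure value p136561, the collision-mark UI p110597) — and what it does NOT supply is split into
two honest stubs: `stub_kineticHalf` (the route's own kinetic half typed over the crux decl NAMES, DEAD AS TYPED until the
planner's R-a/R-b restatement of 17722/13080, exactly line `Sketch`'s finding) and `stub_gronwallInputs` (the external
bundle 13354 ∧ 13481 ∧ 13352 the clamped Grönwall consumes; the alternative that keeps them out — a `Z = id` Grönwall from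
the PLAIN 13081 — is line `plain-entropy-finite-n-bf`'s unbuilt XL shell). 7 stubs = stubs_max; composition re-checked.

DISPROOF USED (`Cruxes/ParityBandClosure/Disproof.lean`, cycle 1, NO KILL): §1 `not_parityBandClosure_iff` — every
stub is a PROOF DEVICE on top of `X`, none restates or weakens the crux (`EntropyNoDipAt` is logically independent
of the Statement: weak convergence at `t` does not give the floor, the floor does not give momentum at `t`); §2 no
`_false_without_<H>` exists (summit-hard both ways) — this skeleton consumes `EvenStressEnskog` and `DensityCap` in
the readout and all five upstream; §3 vacuity channel (unguarded `DensityCap`) — every NEW waypoint here is typed in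
the GUARDED frame of the Statement (`∃ η₀`, `ρσ³ < η₀` along the solution), so no implosion exposure is added;
§5 `not_isEntropyCutoff_id` / BF18Revisited note — G2 lives inside `stub_windowClosure` only; G1 is what this line
removes (`energyConjunct_of_lower` is §5's own pointer); §6 junk audit — `Hs = 0` off `{ρ > 0, θ > 0}` (same `Hs`,
`ρm`, `θm` as `LocalSecondLaw`) HELPS a floor and is neutral in the squeeze (on single-velocity balls
`ρ_r ≤ 3/(πr³(N+1))`, where `s_σ(ρ_r, θ̃) ≥ 3/2` for large `N` and the tangent bound holds with `S := 0`).
Landed Negative lemma `Theorems/ParityBandClosure/Negative/YoungMixingObstruction` (p141493) concerns the kinetic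
half only; no stub below is an instance of it (the readout stubs never separate Young fibres; `stub_windowClosure`
is typed over the route decls by name and carries the obstruction note).
-/

noncomputable section

namespace Summit.AtomisticToContinuum.HydrodynamicLimit.Cruxes.ParityBandClosure.EntropyFloorFixesEnergy

open scoped BigOperators Topology Classical MeasureTheory ENNReal InnerProductSpace
open Filter Set MeasureTheory
open Literature.MathematicalPhysics.KineticTheory
open Literature.Analysis.FluidPDE
open Summit.AtomisticToContinuum.HydrodynamicLimit.Theses

/-! ## §1 Typed waypoints -/

/-- **Mollified fields close in TIME AVERAGE** (VERBATIM the sister waypoint `MollifiedCloseTimeAveraged` of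
`Cruxes/ChaosClosesEuler/Lines/Sketch.lean` v8 and of the dead `Cruxes/ParityBandClosure/Lines/Sketch.lean` v4 — the
honest output of every relative-energy Grönwall on the board and the first hypothesis of the landed readout
`ChaosClosesEulerReadout.stub_readout`): in the guarded frame, for every `t < t + Δ < T`, the window integral of the
three `L¹(dx)` errors of the `r`-cone-mollified empirical density / momentum / energy against the classical fields
exceeds `ηΔ` with small probability (`N → ∞` at fixed `r < r₀(η,δ)`). This line's readout consumes only its
MOMENTUM part. -/
def MollifiedCloseTimeAveraged : Prop :=
  ∃ η₀ : ℝ, 0 < η₀ ∧ ∀ (a₀ θ₀ : T3 → ℝ) (u₀ : T3 → V3), Continuous a₀ → Continuous θ₀ → Continuous u₀ →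
    (∀ x, 0 < a₀ x) → (∀ x, 0 < θ₀ x) → ∃ σ₀ : ℝ, 0 < σ₀ ∧ ∀ σ : ℝ, 0 < σ → σ < σ₀ →
    ∀ (T : ℝ) (ρ θ : ℝ → T3 → ℝ) (u : ℝ → T3 → V3), IsHardSphereEulerSolution σ T ρ u θ →
    (∀ t ∈ Set.Ico 0 T, ∀ x, ρ t x * σ ^ 3 < η₀) →
    ∀ Φ : (N : ℕ) → HardSphereFlow (Torus.geometry (Fin 3)) (hsDiameter σ N) (N + 1),
    TendstoHydroFieldsAt (fun N => localGibbsLaw σ a₀ u₀ θ₀ N (Φ N)) Φ ρ u θ 0 →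
    ∀ t ∈ Set.Ico 0 T, ∀ Δ : ℝ, 0 < Δ → t + Δ < T → ∀ η δ : ℝ, 0 < η → 0 < δ →
    ∃ r₀ : ℝ, 0 < r₀ ∧ ∀ r : ℝ, 0 < r → r < r₀ → ∃ N₀ : ℕ, ∀ N : ℕ, N₀ ≤ N →
    let bx : T3 → T3 → ℝ := fun y x => 3 / (Real.pi * r ^ 3) * max (1 - Torus.euclidDist y x / r) 0
    localGibbsLaw σ a₀ u₀ θ₀ N (Φ N)
        {z | η * Δ < ∫ s in Set.Icc t (t + Δ),
          ((∫ x, |empiricalDensityField ((Φ N).flow s z) (fun y => bx y x) - ρ s x|)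
          + (∫ x, ‖empiricalMomentumField ((Φ N).flow s z) (fun y => bx y x) - ρ s x • u s x‖)
          + ∫ x, |empiricalEnergyField ((Φ N).flow s z) (fun y => bx y x) -
              totalEnergyDensity (ρ s x) (u s x) (θ s x)|)} ≤ ENNReal.ofReal δ

/-- **Weak isotropy of the local pressure tensor, in band, pre-shock** (VERBATIM the sister waypoint
`WeakStressIsotropyInBand` of `Cruxes/ChaosClosesEuler/Lines/Sketch.lean` and of line `plain-entropy-finite-n-bf`; the
output of the route's kinetic half and the input of the landed pressure value p136561): for every continuous TRACELESS
tensor test field `a(s,x)` and continuous cut-off `g` vanishing on `[η₀,∞)`, the space–time integral of `g(σ³ρ_r)·a : P_r`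
tends to `0` in probability (`N → ∞` then `r → 0`). -/
def WeakStressIsotropyInBand : Prop :=
  ∃ η₀ : ℝ, 0 < η₀ ∧ ∀ (a₀ θ₀ : T3 → ℝ) (u₀ : T3 → V3), Continuous a₀ → Continuous θ₀ → Continuous u₀ →
    (∀ x, 0 < a₀ x) → (∀ x, 0 < θ₀ x) → ∃ σ₀ : ℝ, 0 < σ₀ ∧ ∀ σ : ℝ, 0 < σ → σ < σ₀ →
    ∀ (T : ℝ) (ρ θ : ℝ → T3 → ℝ) (u : ℝ → T3 → V3), IsHardSphereEulerSolution σ T ρ u θ →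
    ∀ Φ : (N : ℕ) → HardSphereFlow (Torus.geometry (Fin 3)) (hsDiameter σ N) (N + 1),
    TendstoHydroFieldsAt (fun N => localGibbsLaw σ a₀ u₀ θ₀ N (Φ N)) Φ ρ u θ 0 →
    ∀ t ∈ Set.Ico 0 T, ∀ a : Fin 3 → Fin 3 → ℝ × T3 → ℝ, (∀ j k, Continuous (a j k)) →
    (∀ p, ∑ j : Fin 3, a j j p = 0) →
    ∀ g : ℝ → ℝ, Continuous g → (∀ b, η₀ ≤ b → g b = 0) →
    ∀ η δ : ℝ, 0 < η → 0 < δ → ∃ r₀ : ℝ, 0 < r₀ ∧ ∀ r : ℝ, 0 < r → r < r₀ → ∃ N₀ : ℕ, ∀ N : ℕ, N₀ ≤ N →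
    let bx : T3 → T3 → ℝ := fun y x => 3 / (Real.pi * r ^ 3) * max (1 - Torus.euclidDist y x / r) 0
    let ρm : Config (N + 1) (Fin 3) T3 → T3 → ℝ := fun w x₀ => ∫ q, bx q.1 x₀ ∂(empiricalMeasure w)
    let mm : Config (N + 1) (Fin 3) T3 → T3 → V3 := fun w x₀ => ∫ q, bx q.1 x₀ • q.2 ∂(empiricalMeasure w)
    let Pm : Config (N + 1) (Fin 3) T3 → T3 → Fin 3 → Fin 3 → ℝ := fun w x₀ j k =>
      (∫ q, bx q.1 x₀ * (q.2 j * q.2 k) ∂(empiricalMeasure w)) - mm w x₀ j * mm w x₀ k / ρm w x₀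
    localGibbsLaw σ a₀ u₀ θ₀ N (Φ N)
      {z | η < |∫ s in Set.Icc 0 t, ∫ x, g (σ ^ 3 * ρm ((Φ N).flow s z) x) *
        ∑ j : Fin 3, ∑ k : Fin 3, a j k (s, x) * Pm ((Φ N).flow s z) x j k|} ≤ ENNReal.ofReal δ

/-- **The MOMENTUM third of the conclusion at every instant** (guarded frame of the Statement; body VERBATIM the middle
component of `TendstoHydroFieldsAt … t`): for every continuous `χ` and `δ > 0`, the local-Gibbs probability that the
`χ`-tested empirical momentum at time `t` deviates from `∫ χρ(t)u(t)` by more than `δ` tends to `0`. -/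
def MomentumConjunct : Prop :=
  ∃ η₀ : ℝ, 0 < η₀ ∧ ∀ (a₀ θ₀ : T3 → ℝ) (u₀ : T3 → V3), Continuous a₀ → Continuous θ₀ → Continuous u₀ →
    (∀ x, 0 < a₀ x) → (∀ x, 0 < θ₀ x) → ∃ σ₀ : ℝ, 0 < σ₀ ∧ ∀ σ : ℝ, 0 < σ → σ < σ₀ →
    ∀ (T : ℝ) (ρ θ : ℝ → T3 → ℝ) (u : ℝ → T3 → V3), IsHardSphereEulerSolution σ T ρ u θ →
    (∀ t ∈ Set.Ico 0 T, ∀ x, ρ t x * σ ^ 3 < η₀) →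
    ∀ Φ : (N : ℕ) → HardSphereFlow (Torus.geometry (Fin 3)) (hsDiameter σ N) (N + 1),
    TendstoHydroFieldsAt (fun N => localGibbsLaw σ a₀ u₀ θ₀ N (Φ N)) Φ ρ u θ 0 →
    ∀ t ∈ Set.Ico 0 T, ∀ χ : T3 → ℝ, Continuous χ → ∀ δ > (0 : ℝ),
      Tendsto (fun N => localGibbsLaw σ a₀ u₀ θ₀ N (Φ N)
        {z | δ < ‖empiricalMomentumField ((Φ N).flow t z) χ - ∫ x, (χ x * ρ t x) • u t x‖}) atTop (𝓝 0)

/-- **No local energy DEFICIT at any instant** (guarded frame; body VERBATIM the hypothesis `hlow` of the landed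
`Theorems.energyConjunct_of_lower`): for every NONNEGATIVE continuous `χ` and `δ > 0`, the probability of the lower
deviation `{⟨E_N(t), χ⟩ < ∫ χ E(t) − δ}` tends to `0`. With the exact total energy this IS the energy third of
`TendstoHydroFieldsAt … t` (`energyConjunct_of_lower`: write `χ = (χ + C) − C = C − (C − χ)`). -/
def EnergyFloorConjunct : Prop :=
  ∃ η₀ : ℝ, 0 < η₀ ∧ ∀ (a₀ θ₀ : T3 → ℝ) (u₀ : T3 → V3), Continuous a₀ → Continuous θ₀ → Continuous u₀ →
    (∀ x, 0 < a₀ x) → (∀ x, 0 < θ₀ x) → ∃ σ₀ : ℝ, 0 < σ₀ ∧ ∀ σ : ℝ, 0 < σ → σ < σ₀ →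
    ∀ (T : ℝ) (ρ θ : ℝ → T3 → ℝ) (u : ℝ → T3 → V3), IsHardSphereEulerSolution σ T ρ u θ →
    (∀ t ∈ Set.Ico 0 T, ∀ x, ρ t x * σ ^ 3 < η₀) →
    ∀ Φ : (N : ℕ) → HardSphereFlow (Torus.geometry (Fin 3)) (hsDiameter σ N) (N + 1),
    TendstoHydroFieldsAt (fun N => localGibbsLaw σ a₀ u₀ θ₀ N (Φ N)) Φ ρ u θ 0 →
    ∀ t ∈ Set.Ico 0 T, ∀ χ : T3 → ℝ, Continuous χ → (∀ x, 0 ≤ χ x) → ∀ δ : ℝ, 0 < δ →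
      Tendsto (fun N => localGibbsLaw σ a₀ u₀ θ₀ N (Φ N)
        {z | empiricalEnergyField ((Φ N).flow t z) χ <
          (∫ x, χ x * totalEnergyDensity (ρ t x) (u t x) (θ t x)) - δ}) atTop (𝓝 0)

/-- **FIXED-TIME LOCAL ENTROPY FLOOR** (`EntropyNoDipAt`; the card's one new dynamical input, re-typed from
`IdeatorOneSketch.lean` into the GUARDED frame of the Statement): at a fixed `t ∈ [0,T)`, for every continuous
`ψ ≥ 0`, the `ψ·θ(t,·)`-weighted hard-sphere field entropy of the `r`-cone-mollified empirical fields
`(ρ, m, e)^N_r(t)` is, with local-Gibbs probability `≥ 1 − δ`, not more than `η` BELOW its classical value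
`∫ ψ θ(t) ρ(t) s_σ(ρ(t), θ(t))` (`N → ∞` at fixed `r < r₀(η,δ)`). Written with `Hs = −S_σ`, `ρm`, `mm`, `em`, `θm`
EXACTLY as in `JParityClosure.LocalSecondLaw` (13081): the event is `∫ ψ θ(t,x) (Hs(ρ(t,x),θ(t,x)) − Hs(ρm,θm)) dx < −η`.
Classical solutions are isentropic before the first shock, so the reference value is the transported initial entropy:
this is the fixed-time shadow of the local second law — what `LocalSecondLaw` would say if it carried the boundary
term at `τ = t` (FN2022-type càglàd entropy), in probability with `N → ∞` first (VelocityReversalBarrier evasions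
(i)–(ii)). STRONGER than the energy third it buys (given weak convergence at `t`, no dip ⇔ no sub-`r` oscillation /
no ultra-cold cells at `t`) and NOT derivable from `X` by soft limits (IdeatorOneBarrierNotes B1, phantom conveyor) —
it is a statement about the dynamics, like 9235 was, in second-law currency: one scalar, one-sided, first order in
velocity. Rung 0 (global equilibrium) is static: Gibbs invariance (p72343) + the fixed-`r` LLN uniform in `x` +
continuity of `S_σ` at `(ρ̄, 0, ē)`; at `t = 0` Jensen `S_σ(Ū⋆b_r) ≥ (S_σ∘Ū)⋆b_r` has the favourable sign. -/
def EntropyNoDipAt : Prop :=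
  ∃ η₀ : ℝ, 0 < η₀ ∧ ∀ (a₀ θ₀ : T3 → ℝ) (u₀ : T3 → V3), Continuous a₀ → Continuous θ₀ → Continuous u₀ →
    (∀ x, 0 < a₀ x) → (∀ x, 0 < θ₀ x) → ∃ σ₀ : ℝ, 0 < σ₀ ∧ ∀ σ : ℝ, 0 < σ → σ < σ₀ →
    ∀ (T : ℝ) (ρ θ : ℝ → T3 → ℝ) (u : ℝ → T3 → V3), IsHardSphereEulerSolution σ T ρ u θ →
    (∀ t ∈ Set.Ico 0 T, ∀ x, ρ t x * σ ^ 3 < η₀) →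
    ∀ Φ : (N : ℕ) → HardSphereFlow (Torus.geometry (Fin 3)) (hsDiameter σ N) (N + 1),
    TendstoHydroFieldsAt (fun N => localGibbsLaw σ a₀ u₀ θ₀ N (Φ N)) Φ ρ u θ 0 →
    ∀ t ∈ Set.Ico 0 T, ∀ ψ : T3 → ℝ, Continuous ψ → (∀ x, 0 ≤ ψ x) → ∀ η δ : ℝ, 0 < η → 0 < δ →
    ∃ r₀ : ℝ, 0 < r₀ ∧ ∀ r : ℝ, 0 < r → r < r₀ → ∃ N₀ : ℕ, ∀ N : ℕ, N₀ ≤ N →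
    let bx : T3 → T3 → ℝ := fun x y => 3 / (Real.pi * r ^ 3) * max (1 - Torus.euclidDist x y / r) 0
    let ρm : Config (N + 1) (Fin 3) T3 → T3 → ℝ := fun w x₀ => ∫ q, bx q.1 x₀ ∂(empiricalMeasure w)
    let mm : Config (N + 1) (Fin 3) T3 → T3 → V3 := fun w x₀ => ∫ q, bx q.1 x₀ • q.2 ∂(empiricalMeasure w)
    let em : Config (N + 1) (Fin 3) T3 → T3 → ℝ := fun w x₀ =>
      ∫ q, bx q.1 x₀ * (‖q.2‖ ^ 2 / 2) ∂(empiricalMeasure w)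
    let θm : Config (N + 1) (Fin 3) T3 → T3 → ℝ := fun w x₀ =>
      2 / 3 * (em w x₀ / ρm w x₀ - ‖mm w x₀‖ ^ 2 / (2 * ρm w x₀ ^ 2))
    let Hs : ℝ → ℝ → ℝ := fun a b =>
      if 0 < a ∧ 0 < b then -(a * (3 / 2 * Real.log b - Real.log a - hsExcessFreeEnergy (a * σ ^ 3))) else 0
    localGibbsLaw σ a₀ u₀ θ₀ N (Φ N)
      {z | (∫ x : T3, ψ x * θ t x *
          (Hs (ρ t x) (θ t x) - Hs (ρm ((Φ N).flow t z) x) (θm ((Φ N).flow t z) x))) < -η} ≤ ENNReal.ofReal δ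

/-- **INTEGRABILITY OF THE COARSE-GRAINED FIELD ENTROPY** (`CoarseEntropyIntegrable`; deterministic, skeleton v2).
For `0 < σ`, a scale `0 < r ≤ 1/2`, a band `[0, ηb]` on which `hsExcessFreeEnergy` is continuous, and a configuration
`w` of `N + 1` particles with PAIRWISE DISTINCT velocities whose `r`-cone-mollified density satisfies `ρ_r(x)σ³ ≤ ηb`
everywhere, the map `x ↦ Hs(ρ_r(x), θ_r(x))` — `Hs`, `ρm`, `mm`, `em`, `θm` VERBATIM those of `EntropyNoDipAt` /
`JParityClosure.LocalSecondLaw` — is integrable on `𝕋³`. Why true: off `{ρ_r > 0, θ_r > 0}` it is `0`; `ρ_r`,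
`ρ_r log ρ_r`, `ρ_r f(ρ_rσ³)` are bounded (cap + continuity of `f` on the band); by the Lagrange identity
`θ_r = Σᵢⱼ bᵢbⱼ|vᵢ − vⱼ|²/(6n²ρ_r²)` (`bᵢ(x) = 3/(πr³)(1 − d(qᵢ,x)/r)₊`) and distinct velocities,
`|log θ_r(x)| ≤ C(w) + Σᵢ |log bᵢ(x)|·1{bᵢ(x) > 0}`, a log-singularity across the spheres `d(qᵢ, x) = r`, and
`∫_{d(q,x)<r} |log(1 − d(q,x)/r)| dx = 4πr³∫₀¹u²|log(1−u)|du < ∞` (torus ball ≅ Euclidean ball for `r ≤ 1/2`,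
`DensityCapNegative.measurePreserving_coverMap`, Mathlib `integrableOn_fun_norm_addHaar`). Velocity coincidences are a
null event along the flow (`ChaosClosesEulerReduction.measure_coincSet_eq_zero`), so this is available almost surely. -/
def CoarseEntropyIntegrable : Prop :=
  ∀ (σ r ηb : ℝ), 0 < σ → 0 < r → r ≤ 1 / 2 → ContinuousOn hsExcessFreeEnergy (Set.Icc 0 ηb) →
    ∀ (N : ℕ) (w : Config (N + 1) (Fin 3) T3), (∀ i j : Fin (N + 1), i ≠ j → (w i).2 ≠ (w j).2) →
    let bx : T3 → T3 → ℝ := fun x y => 3 / (Real.pi * r ^ 3) * max (1 - Torus.euclidDist x y / r) 0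
    let ρm : Config (N + 1) (Fin 3) T3 → T3 → ℝ := fun w x₀ => ∫ q, bx q.1 x₀ ∂(empiricalMeasure w)
    let mm : Config (N + 1) (Fin 3) T3 → T3 → V3 := fun w x₀ => ∫ q, bx q.1 x₀ • q.2 ∂(empiricalMeasure w)
    let em : Config (N + 1) (Fin 3) T3 → T3 → ℝ := fun w x₀ =>
      ∫ q, bx q.1 x₀ * (‖q.2‖ ^ 2 / 2) ∂(empiricalMeasure w)
    let θm : Config (N + 1) (Fin 3) T3 → T3 → ℝ := fun w x₀ =>
      2 / 3 * (em w x₀ / ρm w x₀ - ‖mm w x₀‖ ^ 2 / (2 * ρm w x₀ ^ 2))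
    let Hs : ℝ → ℝ → ℝ := fun a b =>
      if 0 < a ∧ 0 < b then -(a * (3 / 2 * Real.log b - Real.log a - hsExcessFreeEnergy (a * σ ^ 3))) else 0
    (∀ x, ρm w x * σ ^ 3 ≤ ηb) →
    Integrable (fun x : T3 => Hs (ρm w x) (θm w x))

/-! ## §2 The stubs -/

/-- STUB (external, VERBATIM the route's own support item stmt-AtomisticToContinuum-13087
`JParityClosure.KineticEnergyTails`): QUADRATIC uniform integrability of the kinetic energy along the flow before the
shock — the only velocity-tail currency of this line (consumed upstream, law → stress; the readout below needs no
uniform integrability at all). Stub-blocked on the board item; never the cubic `EnergyCurrentTails` 9235. -/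
theorem stub_kineticEnergyTails : JParityClosure.KineticEnergyTails := by
  sorry

/-- STUB (UPSTREAM INPUT LAYER, XL; skeleton v3): **the route's kinetic half**, typed over the crux decl NAMES —
`OddContactSymmetry → RateFloor → LocalSecondLaw → DensityCap → KineticEnergyTails → WeakStressIsotropyInBand`. DEAD AS
TYPED (line `Sketch`: `Lines/SketchDead.md`, toy p141493 — fixed-mark 17722 / fixed-`χ` 13080 constrain only the
Young-fibre-AVERAGED limit record; wave-1 worker: the two-fibre counter-model survives the extra hypotheses `LocalSecondLaw`
(a statement about the fibre-averaged mollified fields) and `KineticEnergyTails` (linear in the Young measure), and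
`EvenStressEnskog` fixes only `Ξ_P`-moments of the `J`-even averaged record). It becomes the live kinetic item VERBATIM
once the tenure planner applies R-a (jump-marked odd marks, `SketchRepair.OddContactSymmetryJump`, measure-level consumer
landed p141247) / R-b (`SketchRepair.PointwiseRateFloor`) by `--restate` (decl names are kept); its measure-level chain is
landed (p139072 → p138663/p141247 → p139366 → p137939 ∘ `parityRigidity_proof` ∘ p137300). A seat handed this stub
answers `stub-blocked: restatement of stmt-17722 / stmt-13080 (SketchRepair), not filed`. -/
theorem stub_kineticHalf :
    JParityClosure.OddContactSymmetry → JParityClosure.RateFloor → JParityClosure.LocalSecondLaw →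
    JParityClosure.DensityCap → JParityClosure.KineticEnergyTails → WeakStressIsotropyInBand := by
  sorry

/-- STUB (EXTERNAL bundle; skeleton v3 — a seat handed it answers `stub-blocked` naming the items): the three open board
items the CLAMPED relative-energy Grönwall consumes, VERBATIM by name — `LimitCollisionMeasure.CollisionTightness`
(stmt-13354: quartic tightness of the normalised collision measure ⇒ UI of the quadratic collision mark by the landed
p110597), `InformationPercolationEngine.CollisionRate` (stmt-13481: in-band identification of the cut-off collision COUNT),
`LimitCollisionMeasure.LocalSecondLaw` (stmt-13352: the clamped entropy inequality `Z = clamp a b`). NOT among the crux's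
hypotheses; the alternative keeping them out (a `Z = id` Grönwall from the plain 13081 + a coldness moment) is line
`plain-entropy-finite-n-bf`'s `stub_plainEntropyShell` / `stub_plainKineticReduction` (unbuilt, XL). -/
theorem stub_gronwallInputs :
    LimitCollisionMeasure.CollisionTightness ∧ InformationPercolationEngine.CollisionRate ∧
    LimitCollisionMeasure.LocalSecondLaw := by
  sorry

/-- **The window-averaged closure modulo the kinetic half and the Grönwall inputs — PROVED (skeleton v3, no `sorry`).**
Weak stress isotropy + `EvenStressEnskog` (⇒ the collisional pressure value, landed p136561) + 13354 (⇒ `CollisionMomentUI`,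
landed p110597) + 13481 + the clamped 13352 + `DensityCap` (syntactically `InformationPercolationEngine.DensityCap`) ⇒
`MollifiedCloseTimeAveraged`, by the sister crux's landed chain `ChaosClosesEulerKineticReduction.stub_kineticReduction`
(p138091) fed with `stub_massBalanceC1` (p133127), `stub_weakEquation` (p108039), `stub_initialLayer` (p97752) and the
deterministic shell `stub_bf18Shell` (p136414). Kernel-checked first by the wave-1 worker on `stub_windowClosure`. -/
theorem windowClosure_of_weakStressIsotropy :
    WeakStressIsotropyInBand → JParityClosure.EvenStressEnskog → LimitCollisionMeasure.CollisionTightness →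
    InformationPercolationEngine.CollisionRate → LimitCollisionMeasure.LocalSecondLaw → JParityClosure.DensityCap →
    MollifiedCloseTimeAveraged := by
  intro hW hE hCT hCR hL hD
  have hD' : InformationPercolationEngine.DensityCap := hD
  have hP := Summit.AtomisticToContinuum.HydrodynamicLimit.Theorems.ParityBandClosurePressureValue.stub_pressureValueOfEvenStress
    hE hW
  have hU := Summit.AtomisticToContinuum.HydrodynamicLimit.Theorems.ChaosClosesEulerCollisionMomentUI.stub_collisionMomentUI hCT
  exact Summit.AtomisticToContinuum.HydrodynamicLimit.Theorems.ChaosClosesEulerKineticReduction.stub_kineticReduction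
    Summit.AtomisticToContinuum.HydrodynamicLimit.Theorems.ChaosClosesEulerMassBalanceC1.stub_massBalanceC1
    Summit.AtomisticToContinuum.HydrodynamicLimit.Theorems.ChaosClosesEulerWeakEquation.stub_weakEquation
    Summit.AtomisticToContinuum.HydrodynamicLimit.Theorems.ChaosClosesEulerInitialLayer.stub_initialLayer
    hW hP hU hCR hL hD'
    Summit.AtomisticToContinuum.HydrodynamicLimit.Theorems.ChaosClosesEulerBF18Shell.stub_bf18Shell

/-- **The window-averaged closure from the seven stubs' upstream part** (skeleton v3; this was the single stub
`stub_windowClosure` in v1/v2, same signature, now a composition): kinetic half ∘ Grönwall inputs ∘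
`windowClosure_of_weakStressIsotropy`. -/
theorem windowClosure_of_stubs :
    JParityClosure.OddContactSymmetry → JParityClosure.EvenStressEnskog → JParityClosure.RateFloor →
    JParityClosure.LocalSecondLaw → JParityClosure.DensityCap → JParityClosure.KineticEnergyTails →
    MollifiedCloseTimeAveraged := fun hO hE hR hL hD hK =>
  windowClosure_of_weakStressIsotropy (stub_kineticHalf hO hR hL hD hK) hE stub_gronwallInputs.1
    stub_gronwallInputs.2.1 stub_gronwallInputs.2.2 hD

/-- STUB (OWN, M/L) — **LANDED p149671** (`Theorems/JParityClosureParityBandClosureMomentumAtInstant.lean` + pathwise helper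
p148618, wave-1 worker): **the momentum third at every instant, by quadratic time-regularity**. From the time-averaged
`L¹` identification of the mollified momentum (`MollifiedCloseTimeAveraged`, momentum part; cone commutator
`KineticClosureBridge.norm_empiricalMomentumField_sub_integral_smul_le` + mean speed `≤ √(2K)` turn it into the
`havg` of the upgrade for every `C¹` field `J`), the LANDED windowed equicontinuity in probability of the smooth-tested
empirical momentum — `JParityClosureSpeedJumpWindow.hequi_momentum_of_evenStat_of_cap` (kinetic flux `≤ ‖DJ‖_∞·2E_kin·Δ`,
collisional transfer `≤ ‖DJ‖_∞·ε·½𝒮(t,t+Δ]`, the speed-jump functional `𝒮` being the trace `Σ_k Ξ_P^{kk}` of the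
`EvenStressEnskog` marks, bounded in small windows by `EvenStressEnskog` (`evenStat`, `Iff.rfl` vocabulary) with a
time bump and a density cut-off kept inactive by `DensityCap` + the guard `ρσ³ ≤ η₀/2`; `|Y| ≤ C_Y` on the analytic
band of `HsEosLowDensity_holds`) — and the LANDED upgrade
`JParityClosureMomentumModulus.tendsto_momentumObservable_fixedTime_localGibbs` (∘ `tendsto_measure_fixedTime_of_timeAverage`),
componentwise via `inner_empiricalMomentumField`, smooth → continuous tests by uniform approximation
(`exists_isSmooth_near`, energy tightness `energy_tight_of_tendstoHydroFieldsAt_zero`). `η₀ := min(η₀ᴹ, η₀ᴱˢᴱ/2, η₀ᴱᴼˢ/2)`.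
No velocity moment beyond the conserved kinetic energy. -/
theorem stub_momentumAtInstant :
    MollifiedCloseTimeAveraged → JParityClosure.EvenStressEnskog → JParityClosure.DensityCap →
    MomentumConjunct :=
  Summit.AtomisticToContinuum.HydrodynamicLimit.Theorems.ParityBandClosureMomentumAtInstant.stub_momentumAtInstant

/-- **ANATOMY of the new input (landed p151101, wave-2 worker): the summit conjunct IMPLIES the floor.**
`_root_.HydrodynamicLimit → EntropyNoDipAt` by soft means (fixed-`r` uniform-in-`x` LLN of the cone fields at `t` from
`TendstoHydroFieldsAt … t` + continuity of `Hs` on the regular band). So `EntropyNoDipAt` is NECESSARY for the crux's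
conclusion, and — with `stub_energyFloorOfEntropyFloor`, the landed density third and `stub_momentumAtInstant` — it is
EQUIVALENT to the energy third at the instant (gap G1) modulo `X`: the line converts G1 into second-law currency, it does
not strengthen it (this corrects the v1 docstring's "STRONGER than the energy third"). -/
theorem entropyNoDipAt_of_hydrodynamicLimit : _root_.HydrodynamicLimit → EntropyNoDipAt :=
  Summit.AtomisticToContinuum.HydrodynamicLimit.Theorems.ParityBandClosureEntropyNoDipAtAnatomy.stub_entropyNoDipAtOfHydrodynamicLimit

/-- STUB (OWN, L–XL, THE LOAD-BEARING NEW INPUT): **the fixed-time local entropy floor** `EntropyNoDipAt` (see the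
waypoint's docstring). Two known ways in: (i) ROUTE-LEVEL — restate `LocalSecondLaw` (13081) with the boundary term
at every `τ < T` (`LocalSecondLawAt`, the shape `BoxDissipativeWeakStrong.EntropyAdmissibility` 9903 already has),
then `EntropyNoDipAt` follows from it + `MollifiedCloseTimeAveraged` + uniform integrability of the entropy flux
`ρ_r s_r u_r` on cold-and-fast cells (card `plain-entropy-finite-n-bf`'s soft temperature floor, `ColdCrossBound`
PROVED); (ii) DIRECT — relative entropy w.r.t. the time-`t` local Gibbs state built on the classical fields (Yau's
method at a fixed instant: `H_N(t)/N → 0` ⇒ entropy floor by the Gibbs variational principle), which is where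
`OddContactSymmetry`'s perturbative skeleton would enter. Rung 0 is static (Gibbs invariance p72343 + fixed-`r` LLN).
Why it might fail: an `O(1)` fraction of ultra-cold sub-`r` cells at one instant, fed by anomalous hot→cold
conduction that RAISES total entropy (IdeatorOneBarrierNotes B2), is invisible to every time-integrated hypothesis. -/
theorem stub_entropyNoDipAt : EntropyNoDipAt := by
  sorry

/-- STUB (OWN, M, deterministic; skeleton v2) — **LANDED p148638** (`Theorems/JParityClosureParityBandClosureCoarseEntropy.lean`,
wave-1 worker): **integrability of the coarse-grained field entropy** — body VERBATIM `CoarseEntropyIntegrable` (domination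
by `Σᵢ |log bᵢ(x)|`, torus-ball reduction). Without it the Bochner-integral event of `EntropyNoDipAt` is junk-vacuous. -/
theorem stub_coarseEntropyIntegrable : CoarseEntropyIntegrable :=
  Summit.AtomisticToContinuum.HydrodynamicLimit.Theorems.ParityBandClosureCoarseEntropy.stub_coarseEntropyIntegrable

/-- STUB (OWN, L, THE LEVER; skeleton v2 takes `CoarseEntropyIntegrable` first) — **LANDED** (lead a1: p147005, p149279, p150470,
p151116 = `Theorems/JParityClosureParityBandClosureEnergyFloor{Pointwise,Integrated,Pathwise,}.lean`) — the one-sided isentropic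
squeeze at the instant: **entropy floor + density cap + momentum third ⇒ no local energy deficit**, at every
`t`, for every continuous `ψ ≥ 0`. Pointwise (★): `e_r ≥ −θ̃ Hs(ρ_r,θ_r) − θ̃ g̃(ρ_r) + (3/2)ρ_rθ̃ + |m_r|²/(2ρ_r)`
with `g̃(ρ) = ρ(3/2 log θ̃ − log ρ − f_ex(ρσ³))` — on `{ρ_r > 0, θ_r > 0}` this is `log x ≤ x − 1` (the `f_ex` terms
CANCEL, no band needed; `IdeatorOne.fieldEntropy_le_tangent`), on `{ρ_r = 0}` all terms vanish, on `{ρ_r > 0, θ_r = 0}`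
(Lagrange identity ⇒ with pairwise distinct velocities exactly one particle carries positive cone weight, so
`ρ_r ≤ 3/(πr³(N+1))`) it holds as soon as `g̃(ρ_r) ≥ (3/2)ρ_r`, i.e. for `N ≥ N₁(r)`. Then, with
`−θ̃Hs(ρ_r,θ_r) = θ̃(Hs(ρ̃,θ̃) − Hs(ρ_r,θ_r)) + θ̃g̃(ρ̃)`, the ONE-SIDED density step
`g̃(ρ_r) − g̃(ρ̃) ≤ (|g₁′(ρ̃)| + Lip g₂)|ρ_r − ρ̃|` (`g₁(ρ) = ρ(c − log ρ)` concave — tangent at `ρ̃ ≥ ρ_min > 0`;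
`g₂(ρ) = −ρ f_ex(ρσ³)` Lipschitz on the analytic band of `HsEosLowDensity_holds`, where `ρ_rσ³` stays by the sup-cap
`DensityCap` + the guard) and `|m|²/(2ρ) ≥ ũ·m − ρ|ũ|²/2`:
`ψe_r ≥ ψẼ + ψθ̃(Hs(ρ̃,θ̃) − Hs(ρ_r,θ_r)) − C_t ψ|ρ_r − ρ̃| + ψũ·(m_r − ρ̃ũ)` POINTWISE; integrate
(`CoarseEntropyIntegrable` on the coincidence-free, capped event — coincidences are null,
`ChaosClosesEulerReduction.measure_coincSet_eq_zero` + `localGibbsLaw_absolutelyContinuous`): `∫ψe_r ≥ ∫ψẼ − η`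
(`EntropyNoDipAt`) `− C_t‖ρ_r − ρ̃‖₁` (`ParityInBandDensity.densityCap_mollDensity_L1_at`) `− Σ_k|∫ψũ_k((m_r)_k − ρ̃ũ_k)|`
(`MomentumConjunct` with tests `ψũ_k` + cone commutator `KineticClosureBridge.norm_empiricalMomentumField_sub_integral_smul_le`);
finally `⟨E_N(t),ψ⟩ ≥ ∫ψe_r − ω_ψ(r)K` (`abs_empiricalEnergyField_sub_integral_mul_le`, energy tightness
`exists_energy_tail_le`). Order: `η`, then `r`, then `N`. `η₀ := min(η₀ᶠˡᵒᵒʳ, η₀ᴹᵒᵐ, η_E/4)`. -/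
theorem stub_energyFloorOfEntropyFloor :
    CoarseEntropyIntegrable → EntropyNoDipAt → JParityClosure.DensityCap → MomentumConjunct →
    EnergyFloorConjunct :=
  Summit.AtomisticToContinuum.HydrodynamicLimit.Theorems.ParityBandClosureEnergyFloor.stub_energyFloorOfEntropyFloor

/-! ## §3 The composition (no `sorry` of its own) -/

/-- **The line closes the crux modulo its stubs.** The crux BY NAME, proved from the seven declared stubs (used by name:
`stub_kineticEnergyTails`, `stub_kineticHalf` + `stub_gronwallInputs` (through the proved `windowClosure_of_stubs`),
`stub_momentumAtInstant`, `stub_entropyNoDipAt`, `stub_coarseEntropyIntegrable`, `stub_energyFloorOfEntropyFloor`) and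
LANDED theorems only — density third `ParityInBandDensity.parityInBand_densityField_of_densityCap`,
energy one-sidedness `Theorems.energyConjunct_of_lower` — plus threshold bookkeeping (`η₀ := min η₀ᴹᵒᵐ (min η₀ᶠˡᵒᵒʳ η₀ᴱ)`,
`σ₀ := min σ₁ (min σ₂ σ₄)`) and the componentwise assembly of `TendstoHydroFieldsAt … t`. Consumed at the instant:
`EvenStressEnskog`, `DensityCap`; `OddContactSymmetry`, `RateFloor`, `LocalSecondLaw` enter upstream only (`stub_windowClosure`).
Its only axioms beyond the standard three are the stubs' `sorryAx`. -/
theorem ParityBandClosure_of :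
    Summit.AtomisticToContinuum.HydrodynamicLimit.Theses.JParityClosure.ParityBandClosure := by
  intro hO hE hR hL hD
  have hM : MollifiedCloseTimeAveraged := windowClosure_of_stubs hO hE hR hL hD stub_kineticEnergyTails
  have hMom : MomentumConjunct := stub_momentumAtInstant hM hE hD
  have hEn : EnergyFloorConjunct :=
    stub_energyFloorOfEntropyFloor stub_coarseEntropyIntegrable stub_entropyNoDipAt hD hMom
  obtain ⟨η₁, hη₁, H₁⟩ := hMom
  obtain ⟨η₂, hη₂, H₂⟩ := hEn
  obtain ⟨η₃, hη₃, H₃⟩ := Summit.AtomisticToContinuum.HydrodynamicLimit.Theorems.energyConjunct_of_lower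
  refine ⟨min η₁ (min η₂ η₃), lt_min hη₁ (lt_min hη₂ hη₃), fun a₀ θ₀ u₀ ha hθ hu ha0 hθ0 => ?_⟩
  obtain ⟨σ₁, hσ₁, K₁⟩ := H₁ a₀ θ₀ u₀ ha hθ hu ha0 hθ0
  obtain ⟨σ₂, hσ₂, K₂⟩ := H₂ a₀ θ₀ u₀ ha hθ hu ha0 hθ0
  obtain ⟨σ₄, hσ₄, K₄⟩ :=
    Summit.AtomisticToContinuum.HydrodynamicLimit.Theorems.ParityInBandDensity.parityInBand_densityField_of_densityCap
      hD a₀ θ₀ u₀ ha hθ hu ha0 hθ0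
  refine ⟨min σ₁ (min σ₂ σ₄), lt_min hσ₁ (lt_min hσ₂ hσ₄), fun σ hσ hσlt T ρ θ u hsol hguard Φ h0 t ht => ?_⟩
  have hσ1 : σ < σ₁ := hσlt.trans_le (min_le_left _ _)
  have hσ2 : σ < σ₂ := hσlt.trans_le ((min_le_right _ _).trans (min_le_left _ _))
  have hσ4 : σ < σ₄ := hσlt.trans_le ((min_le_right _ _).trans (min_le_right _ _))
  have hg1 : ∀ s ∈ Set.Ico 0 T, ∀ x, ρ s x * σ ^ 3 < η₁ := fun s hs x =>
    (hguard s hs x).trans_le (min_le_left _ _)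
  have hg2 : ∀ s ∈ Set.Ico 0 T, ∀ x, ρ s x * σ ^ 3 < η₂ := fun s hs x =>
    (hguard s hs x).trans_le ((min_le_right _ _).trans (min_le_left _ _))
  have hg3 : ∀ s ∈ Set.Ico 0 T, ∀ x, ρ s x * σ ^ 3 < η₃ := fun s hs x =>
    (hguard s hs x).trans_le ((min_le_right _ _).trans (min_le_right _ _))
  have hDen := K₄ σ hσ hσ4 T ρ θ u hsol Φ h0 t ht
  have hMo := K₁ σ hσ hσ1 T ρ θ u hsol hg1 Φ h0 t ht
  have hLow := K₂ σ hσ hσ2 T ρ θ u hsol hg2 Φ h0 t ht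
  have hEner := H₃ σ T a₀ θ₀ u₀ ρ θ u hσ hsol hg3 Φ h0 t ht hLow
  intro χ hχ δ hδ
  exact ⟨hDen χ hχ δ hδ, hMo χ hχ δ hδ, hEner χ hχ δ hδ⟩

end Summit.AtomisticToContinuum.HydrodynamicLimit.Cruxes.ParityBandClosure.EntropyFloorFixesEnergy

end
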